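import Summits.Parity.GeneralizedHardyLittlewood.Theorems.GreenTaoLevelTwoMNTwoBohrGauge
import Summits.Parity.GeneralizedHardyLittlewood.Theorems.GreenTaoLevelTwoMNTwoRotationBohrSize

/-!
# Route `GreenTaoLevelTwo`, crux `MNTwo` (stmt-Parity-21276), line `birth`, stub `stub_mnVertical`:
# Lemma 28, geometric half, step 1: rational perturbation of the rotation gauge (GT 2008b §11)

Block V5 / H5 of the `stub_mnVertical` census (B. Green, T. Tao, *Quadratic uniformity of the
Möbius function*, Ann. Inst. Fourier 58 (2008) = arXiv:math/0606087, §11, proof of Lemma 28: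
"Recall … that `g ∈ (ℝ/ℤ)^d` can be taken to be a `p`-th root of unity … This is such an argument.
We identify `B_g(0,ρ₂)` … with a subset of `ℤ/pℤ`. Write `g = (ξ₁/p,…,ξ_d/p)`").  In the tree's
`hInv` the frequencies `α : Fin k → ℝ` are real; the reduction to rational frequencies is done at
finite scale instead: replacing `αᵢ` by `aᵢ/M` with `|αᵢ − aᵢ/M| ≤ 1/(2M)` and `M ≥ N` changes the
rotation gauge `ν(n) = maxᵢ‖nαᵢ‖ + |n|/N` by at most `|n|/(2M) ≤ ν(n)/2`, so the two gauges are
comparable within a factor `3/2` — after which the Bohr-set lattice is an INTEGER lattice and the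
tree's LLL-reduced generators (`…GITwoCyclicInverseLLLCoeff.exists_reduced_generators_int`) apply
(next file).  Def-free.

* `exists_round_div` — `aᵢ := round(Mαᵢ)` has `|αᵢ − aᵢ/M| ≤ 1/(2M)`;
* `abs_norm_coe_mul_sub_le` — `|‖nα‖ − ‖nα'‖| ≤ |n|·|α − α'|` on `ℝ/ℤ`;
* `abs_iSup_norm_sub_le` — the same for `maxᵢ‖nαᵢ‖`;
* `rotationGauge_perturb_le` — **`|ν(n) − ν̃(n)| ≤ ν(n)/2` and `≤ ν̃(n)/2`** when
  `|αᵢ − α̃ᵢ| ≤ 1/(2M)`, `N ≤ M`.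

References: [GreenTao2008QuadraticMobius] arXiv:math/0606087 §11, proof of Lemma 28.
-/

noncomputable section

open Finset Real

namespace Summit.Parity.GeneralizedHardyLittlewood.GreenTaoLevelTwoMNTwoRationalGauge

open Summit.Parity.GeneralizedHardyLittlewood.GreenTaoLevelTwoMNTwoBohrGauge
  (bddAbove_range_norm iSup_norm_nonneg)
open Summit.Parity.GeneralizedHardyLittlewood.GreenTaoLevelTwoMNTwoRotationBohrSize
  (norm_coe_le_abs')

/-- Rounding: for `M > 0`, `aᵢ := round(Mαᵢ)` satisfies `|αᵢ − aᵢ/M| ≤ 1/(2M)`. [folklore] -/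
theorem exists_round_div {k : ℕ} (α : Fin k → ℝ) {M : ℝ} (hM : 0 < M) :
    ∃ a : Fin k → ℤ, ∀ i, |α i - (a i : ℝ) / M| ≤ 1 / (2 * M) := by
  refine ⟨fun i => round (M * α i), fun i => ?_⟩
  have h := abs_sub_round (M * α i)
  have e : α i - (round (M * α i) : ℝ) / M = (M * α i - round (M * α i)) / M := by
    field_simp
  rw [e, abs_div, abs_of_pos hM, div_le_div_iff₀ hM (by positivity)]
  nlinarith

/-- `|‖nα‖ − ‖nα'‖| ≤ |n|·|α − α'|` in `ℝ/ℤ`. [folklore] -/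
theorem abs_norm_coe_mul_sub_le (n : ℤ) (α α' : ℝ) :
    |‖(((n : ℝ) * α : ℝ) : AddCircle (1 : ℝ))‖ - ‖(((n : ℝ) * α' : ℝ) : AddCircle (1 : ℝ))‖| ≤
      |(n : ℝ)| * |α - α'| := by
  refine (abs_norm_sub_norm_le _ _).trans ?_
  rw [← AddCircle.coe_sub, ← mul_sub]
  refine (norm_coe_le_abs' _).trans ?_
  rw [abs_mul]

/-- The same for the maximum over finitely many frequencies:
`|maxᵢ‖nαᵢ‖ − maxᵢ‖nα̃ᵢ‖| ≤ |n|·η` if `|αᵢ − α̃ᵢ| ≤ η` for all `i`. [folklore] -/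
theorem abs_iSup_norm_sub_le {k : ℕ} (α α' : Fin k → ℝ) {η : ℝ} (hη : 0 ≤ η)
    (h : ∀ i, |α i - α' i| ≤ η) (n : ℤ) :
    |(⨆ i : Fin k, ‖(((n : ℝ) * α i : ℝ) : AddCircle (1 : ℝ))‖) -
        (⨆ i : Fin k, ‖(((n : ℝ) * α' i : ℝ) : AddCircle (1 : ℝ))‖)| ≤ |(n : ℝ)| * η := by
  have key : ∀ (β β' : Fin k → ℝ), (∀ i, |β i - β' i| ≤ η) →
      (⨆ i : Fin k, ‖(((n : ℝ) * β i : ℝ) : AddCircle (1 : ℝ))‖) ≤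
        (⨆ i : Fin k, ‖(((n : ℝ) * β' i : ℝ) : AddCircle (1 : ℝ))‖) + |(n : ℝ)| * η := by
    intro β β' hβ
    rcases isEmpty_or_nonempty (Fin k) with hk | hk
    · rw [Real.iSup_of_isEmpty, Real.iSup_of_isEmpty, zero_add]; positivity
    · refine ciSup_le fun i => ?_
      have h1 := abs_norm_coe_mul_sub_le n (β i) (β' i)
      have h2 : |(n : ℝ)| * |β i - β' i| ≤ |(n : ℝ)| * η :=
        mul_le_mul_of_nonneg_left (hβ i) (abs_nonneg _)
      have h3 := le_ciSup (bddAbove_range_norm β' n) i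
      have h4 := (le_abs_self _).trans (h1.trans h2)
      linarith
  rw [abs_le]
  constructor
  · have := key α' α (fun i => by rw [abs_sub_comm]; exact h i)
    linarith
  · have := key α α' h
    linarith

/-- **The rotation gauge under rational perturbation.**  Let `ν(n) = maxᵢ‖nαᵢ‖ + |n|/N` and
`ν̃(n) = maxᵢ‖nα̃ᵢ‖ + |n|/N` with `|αᵢ − α̃ᵢ| ≤ 1/(2M)` for all `i` and `0 < N ≤ M`.  Then
`|ν(n) − ν̃(n)| ≤ ν(n)/2` and `|ν(n) − ν̃(n)| ≤ ν̃(n)/2`; in particular `ν̃ ≤ (3/2)ν` and `ν ≤ (3/2)ν̃`.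
[cite: GreenTao2008QuadraticMobius, §11, proof of Lemma 28 (reduction to rational frequencies)] -/
theorem rotationGauge_perturb_le {k N : ℕ} (hN : 1 ≤ N) (α α' : Fin k → ℝ) {M : ℝ}
    (hNM : (N : ℝ) ≤ M) (h : ∀ i, |α i - α' i| ≤ 1 / (2 * M)) (n : ℤ) :
    |((⨆ i : Fin k, ‖(((n : ℝ) * α i : ℝ) : AddCircle (1 : ℝ))‖) + |(n : ℝ)| / N) -
        ((⨆ i : Fin k, ‖(((n : ℝ) * α' i : ℝ) : AddCircle (1 : ℝ))‖) + |(n : ℝ)| / N)| ≤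
      (|(n : ℝ)| / N) / 2 ∧
    |((⨆ i : Fin k, ‖(((n : ℝ) * α i : ℝ) : AddCircle (1 : ℝ))‖) + |(n : ℝ)| / N) -
        ((⨆ i : Fin k, ‖(((n : ℝ) * α' i : ℝ) : AddCircle (1 : ℝ))‖) + |(n : ℝ)| / N)| ≤
      ((⨆ i : Fin k, ‖(((n : ℝ) * α i : ℝ) : AddCircle (1 : ℝ))‖) + |(n : ℝ)| / N) / 2 ∧
    |((⨆ i : Fin k, ‖(((n : ℝ) * α i : ℝ) : AddCircle (1 : ℝ))‖) + |(n : ℝ)| / N) -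
        ((⨆ i : Fin k, ‖(((n : ℝ) * α' i : ℝ) : AddCircle (1 : ℝ))‖) + |(n : ℝ)| / N)| ≤
      ((⨆ i : Fin k, ‖(((n : ℝ) * α' i : ℝ) : AddCircle (1 : ℝ))‖) + |(n : ℝ)| / N) / 2 := by
  have hNpos : (0 : ℝ) < N := by exact_mod_cast hN
  have hMpos : 0 < M := lt_of_lt_of_le hNpos hNM
  have hη : (0 : ℝ) ≤ 1 / (2 * M) := by positivity
  have hmain := abs_iSup_norm_sub_le α α' hη h n
  rw [add_sub_add_right_eq_sub]
  have hb : |(n : ℝ)| * (1 / (2 * M)) ≤ (|(n : ℝ)| / N) / 2 := by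
    rw [mul_one_div, div_div, div_le_div_iff₀ (by positivity) (by positivity)]
    have := abs_nonneg (n : ℝ)
    nlinarith
  have h1 := hmain.trans hb
  have hs := iSup_norm_nonneg α n
  have hs' := iSup_norm_nonneg α' n
  refine ⟨h1, h1.trans ?_, h1.trans ?_⟩
  · have : 0 ≤ |(n : ℝ)| / N := by positivity
    linarith
  · have : 0 ≤ |(n : ℝ)| / N := by positivity
    linarith

end Summit.Parity.GeneralizedHardyLittlewood.GreenTaoLevelTwoMNTwoRationalGauge
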